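import Summits.CriticalPhenomena.PercolationContinuityZ3.Theorems.PercNearOneGluingAdditiveGluingExchangeResidual
import HarnessLib

/-!
# Crux `PercNearOneGluing.AdditiveGluing` (stmt-CriticalPhenomena-4576): assembly on top of the three-relay RESIDUAL reduction
# (seat (d) exchange-certificate form, gen 3)

Support file (`--supports stmt-CriticalPhenomena-4576`); no definitions, no named facts, no sorries.  CONDITIONAL results (the
residual hypothesis `hRES` of `eform3_of_residual`, file `…ExchangeResidual`, is spelled out verbatim).
* `threeRelays_eform_of_residual`: the E-form `μ((o↔x ∪ o↔y ∪ o↔z) ∖ o↔b) ≤ t` for ANY three distinct relays (choose the worst);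
* `additiveGluing_of_erase_card_le_three_of_residual`: the crux statement `μ(o ↔ A) − t ≤ μ(o ↔ b)` for every `A` with
  `(A.erase b).card ≤ 3` (bookkeeping of deep seat r2's `additiveGluing_of_erase_card_le_three_of_regionCert`);
* `threeRelaysFullTieAllBad_of_residual`: the registered stub `stub_threeRelaysFullTieAllBad_pl` of the official skeleton (verbatim
  signature; its tie / all-bad / positivity hypotheses are not needed).
[cite: KozmaNitzan2024, Conjecture 1 (p. 3), Theorem 2 (§3.1, pp. 8–9)]
-/

namespace Summit.CriticalPhenomena.PercolationContinuityZ3.Theorems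

open MeasureTheory Set Literature.Probability.LatticeModels Literature.Probability.Percolation

noncomputable section
open Classical

variable {n : ℕ}

/-- **E-form for any three distinct relays from the residual** (choose the worst relay; bookkeeping as in
`threeRelays_eform_of_regionCert`). [cite: KozmaNitzan2024, Theorem 2 (§3.1, pp. 8–9)] -/
theorem threeRelays_eform_of_residual
    (hRES : ∀ (n : ℕ) (w : Sym2 (Fin n) → unitInterval) (o b a₁ a₂ a₃ : Fin n),
      a₁ ≠ a₂ → a₁ ≠ a₃ → a₂ ≠ a₃ → o ≠ a₁ → o ≠ a₂ → o ≠ a₃ →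
      -- `a₃` worst, `τ₁ ≤ τ₂` (w.l.o.g.), nontrivial, bad
      (prodBernoulli w).real (openConn a₃ b) ≤ (prodBernoulli w).real (openConn a₁ b) →
      (prodBernoulli w).real (openConn a₁ b) ≤ (prodBernoulli w).real (openConn a₂ b) →
      (prodBernoulli w).real (openConn o b) < (prodBernoulli w).real (openConn a₃ b) →
      (prodBernoulli w).real (openConn b a₁ ∩ openConn b a₂ ∩ (openConn b a₃)ᶜ) <
        (prodBernoulli w).real (openConn b a₃ ∩ (openConn b a₁)ᶜ ∩ (openConn b a₂)ᶜ) →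
      -- the single-exchange charts fail: ¬(G1), ¬(G2)
      (prodBernoulli w).real (openConn o a₁ ∩ (openConn o a₂)ᶜ ∩ (openConn o a₃)ᶜ ∩ openConn a₁ b) + (prodBernoulli w).real ((openConn o a₁ ∪ openConn o a₂ ∪ openConn o a₃)ᶜ ∩ (openConn a₃ b)ᶜ) <
        (prodBernoulli w).real (openConn o a₁ ∩ (openConn o a₂)ᶜ ∩ (openConn o a₃)ᶜ ∩ openConn a₃ b) →
      (prodBernoulli w).real (openConn o a₂ ∩ (openConn o a₁)ᶜ ∩ (openConn o a₃)ᶜ ∩ openConn a₂ b) + (prodBernoulli w).real ((openConn o a₁ ∪ openConn o a₂ ∪ openConn o a₃)ᶜ ∩ (openConn a₃ b)ᶜ) <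
        (prodBernoulli w).real (openConn o a₂ ∩ (openConn o a₁)ᶜ ∩ (openConn o a₃)ᶜ ∩ openConn a₃ b) →
      -- the two-weak-singles charts B, C, D fail (at most one single refined attachment is `≤ 1/2`)
      ¬ (2 * (prodBernoulli w).real ((openConn a₁ a₂)ᶜ ∩ (openConn a₁ a₃)ᶜ ∩ ((openConn o a₂)ᶜ ∩ (openConn o a₃)ᶜ) ∩ openConn a₁ o) ≤ (prodBernoulli w).real ((openConn a₁ a₂)ᶜ ∩ (openConn a₁ a₃)ᶜ ∩ ((openConn o a₂)ᶜ ∩ (openConn o a₃)ᶜ)) ∧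
         2 * (prodBernoulli w).real ((openConn a₂ a₁)ᶜ ∩ (openConn a₂ a₃)ᶜ ∩ ((openConn o a₁)ᶜ ∩ (openConn o a₃)ᶜ) ∩ openConn a₂ o) ≤ (prodBernoulli w).real ((openConn a₂ a₁)ᶜ ∩ (openConn a₂ a₃)ᶜ ∩ ((openConn o a₁)ᶜ ∩ (openConn o a₃)ᶜ))) →
      ¬ (2 * (prodBernoulli w).real ((openConn a₂ a₁)ᶜ ∩ (openConn a₂ a₃)ᶜ ∩ ((openConn o a₁)ᶜ ∩ (openConn o a₃)ᶜ) ∩ openConn a₂ o) ≤ (prodBernoulli w).real ((openConn a₂ a₁)ᶜ ∩ (openConn a₂ a₃)ᶜ ∩ ((openConn o a₁)ᶜ ∩ (openConn o a₃)ᶜ)) ∧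
         2 * (prodBernoulli w).real ((openConn a₃ a₁)ᶜ ∩ (openConn a₃ a₂)ᶜ ∩ ((openConn o a₁)ᶜ ∩ (openConn o a₂)ᶜ) ∩ openConn a₃ o) ≤ (prodBernoulli w).real ((openConn a₃ a₁)ᶜ ∩ (openConn a₃ a₂)ᶜ ∩ ((openConn o a₁)ᶜ ∩ (openConn o a₂)ᶜ))) →
      ¬ (2 * (prodBernoulli w).real ((openConn a₁ a₂)ᶜ ∩ (openConn a₁ a₃)ᶜ ∩ ((openConn o a₂)ᶜ ∩ (openConn o a₃)ᶜ) ∩ openConn a₁ o) ≤ (prodBernoulli w).real ((openConn a₁ a₂)ᶜ ∩ (openConn a₁ a₃)ᶜ ∩ ((openConn o a₂)ᶜ ∩ (openConn o a₃)ᶜ)) ∧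
         2 * (prodBernoulli w).real ((openConn a₃ a₁)ᶜ ∩ (openConn a₃ a₂)ᶜ ∩ ((openConn o a₁)ᶜ ∩ (openConn o a₂)ᶜ) ∩ openConn a₃ o) ≤ (prodBernoulli w).real ((openConn a₃ a₁)ᶜ ∩ (openConn a₃ a₂)ᶜ ∩ ((openConn o a₁)ᶜ ∩ (openConn o a₂)ᶜ))) →
      -- the Kozma–Nitzan Theorem-2 certificate with room (T1) fails
      ¬ (0 ≤
      (prodBernoulli w).real ((openConn a₁ a₃)ᶜ ∩ (openConn a₂ a₃)ᶜ ∩ (openConn a₁ o ∪ openConn a₂ o)) *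
            (prodBernoulli w).real ((openConn a₁ a₂)ᶜ ∩ (openConn a₁ a₃)ᶜ : Set (BondConfig (Fin n))) *
            (prodBernoulli w).real ((openConn a₂ a₁)ᶜ ∩ (openConn a₂ a₃)ᶜ : Set (BondConfig (Fin n))) *
          ((prodBernoulli w).real ((openConn a₁ a₃)ᶜ ∩ (openConn a₂ a₃)ᶜ ∩ (openConn a₁ b ∩ openConn a₂ b)) -
            (prodBernoulli w).real ((openConn a₁ a₃)ᶜ ∩ (openConn a₂ a₃)ᶜ ∩ openConn a₃ b)) +
        (prodBernoulli w).real ((openConn a₁ a₂)ᶜ ∩ (openConn a₁ a₃)ᶜ ∩ openConn a₁ o) *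
            (prodBernoulli w).real ((openConn a₁ a₃)ᶜ ∩ (openConn a₂ a₃)ᶜ : Set (BondConfig (Fin n))) *
            (prodBernoulli w).real ((openConn a₂ a₁)ᶜ ∩ (openConn a₂ a₃)ᶜ : Set (BondConfig (Fin n))) *
          ((prodBernoulli w).real ((openConn a₁ a₂)ᶜ ∩ (openConn a₁ a₃)ᶜ ∩ openConn a₁ b) -
            (prodBernoulli w).real ((openConn a₁ a₂)ᶜ ∩ (openConn a₁ a₃)ᶜ ∩ (openConn a₂ b ∩ openConn a₃ b))) +
        (prodBernoulli w).real ((openConn a₂ a₁)ᶜ ∩ (openConn a₂ a₃)ᶜ ∩ openConn a₂ o) *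
            (prodBernoulli w).real ((openConn a₁ a₃)ᶜ ∩ (openConn a₂ a₃)ᶜ : Set (BondConfig (Fin n))) *
            (prodBernoulli w).real ((openConn a₁ a₂)ᶜ ∩ (openConn a₁ a₃)ᶜ : Set (BondConfig (Fin n))) *
          ((prodBernoulli w).real ((openConn a₂ a₁)ᶜ ∩ (openConn a₂ a₃)ᶜ ∩ openConn a₂ b) -
            (prodBernoulli w).real ((openConn a₂ a₁)ᶜ ∩ (openConn a₂ a₃)ᶜ ∩ (openConn a₁ b ∩ openConn a₃ b))) +
        (prodBernoulli w).real ((openConn a₁ a₂)ᶜ ∩ (openConn a₁ a₃)ᶜ : Set (BondConfig (Fin n))) *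
            (prodBernoulli w).real ((openConn a₂ a₁)ᶜ ∩ (openConn a₂ a₃)ᶜ : Set (BondConfig (Fin n))) *
            (prodBernoulli w).real ((openConn a₁ a₃)ᶜ ∩ (openConn a₂ a₃)ᶜ : Set (BondConfig (Fin n))) *
          (prodBernoulli w).real
            ((openConn o a₁ ∪ openConn o a₂ ∪ openConn o a₃)ᶜ ∩ (openConn a₃ b)ᶜ : Set (BondConfig (Fin n)))) →
      -- the refined Kozma–Nitzan certificate (source sets with the observer adjoined) fails
      ¬ (0 < (prodBernoulli w).real
          ((openConn a₁ a₃)ᶜ ∩ (openConn a₂ a₃)ᶜ ∩ (openConn o a₃)ᶜ : Set (BondConfig (Fin n))) ∧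
        0 < (prodBernoulli w).real
          ((openConn a₁ a₂)ᶜ ∩ (openConn a₁ a₃)ᶜ ∩ ((openConn o a₂)ᶜ ∩ (openConn o a₃)ᶜ) : Set (BondConfig (Fin n))) ∧
        0 < (prodBernoulli w).real
          ((openConn a₂ a₁)ᶜ ∩ (openConn a₂ a₃)ᶜ ∩ ((openConn o a₁)ᶜ ∩ (openConn o a₃)ᶜ) : Set (BondConfig (Fin n))) ∧
        0 ≤
        (prodBernoulli w).real ((openConn a₁ a₂)ᶜ ∩ (openConn a₁ a₃)ᶜ ∩ ((openConn o a₂)ᶜ ∩ (openConn o a₃)ᶜ) : Set (BondConfig (Fin n)))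
          * (prodBernoulli w).real ((openConn a₂ a₁)ᶜ ∩ (openConn a₂ a₃)ᶜ ∩ ((openConn o a₁)ᶜ ∩ (openConn o a₃)ᶜ) : Set (BondConfig (Fin n)))
          * ((prodBernoulli w).real ((openConn a₁ a₃)ᶜ ∩ (openConn a₂ a₃)ᶜ ∩ (openConn o a₃)ᶜ ∩ (openConn a₁ o ∪ openConn a₂ o))
            * ((prodBernoulli w).real ((openConn a₁ a₃)ᶜ ∩ (openConn a₂ a₃)ᶜ ∩ (openConn o a₃)ᶜ ∩ (openConn a₁ b ∩ openConn a₂ b))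
              - (prodBernoulli w).real ((openConn a₁ a₃)ᶜ ∩ (openConn a₂ a₃)ᶜ ∩ (openConn o a₃)ᶜ ∩ openConn a₃ b)))
      + (prodBernoulli w).real ((openConn a₂ a₁)ᶜ ∩ (openConn a₂ a₃)ᶜ ∩ ((openConn o a₁)ᶜ ∩ (openConn o a₃)ᶜ) : Set (BondConfig (Fin n)))
          * (prodBernoulli w).real ((openConn a₁ a₃)ᶜ ∩ (openConn a₂ a₃)ᶜ ∩ (openConn o a₃)ᶜ : Set (BondConfig (Fin n)))
          * ((prodBernoulli w).real ((openConn a₁ a₂)ᶜ ∩ (openConn a₁ a₃)ᶜ ∩ ((openConn o a₂)ᶜ ∩ (openConn o a₃)ᶜ) ∩ openConn a₁ o)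
            * ((prodBernoulli w).real ((openConn a₁ a₂)ᶜ ∩ (openConn a₁ a₃)ᶜ ∩ ((openConn o a₂)ᶜ ∩ (openConn o a₃)ᶜ) ∩ openConn a₁ b)
              - (prodBernoulli w).real ((openConn a₁ a₂)ᶜ ∩ (openConn a₁ a₃)ᶜ ∩ ((openConn o a₂)ᶜ ∩ (openConn o a₃)ᶜ) ∩ (openConn a₂ b ∩ openConn a₃ b))))
      + (prodBernoulli w).real ((openConn a₁ a₂)ᶜ ∩ (openConn a₁ a₃)ᶜ ∩ ((openConn o a₂)ᶜ ∩ (openConn o a₃)ᶜ) : Set (BondConfig (Fin n)))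
          * (prodBernoulli w).real ((openConn a₁ a₃)ᶜ ∩ (openConn a₂ a₃)ᶜ ∩ (openConn o a₃)ᶜ : Set (BondConfig (Fin n)))
          * ((prodBernoulli w).real ((openConn a₂ a₁)ᶜ ∩ (openConn a₂ a₃)ᶜ ∩ ((openConn o a₁)ᶜ ∩ (openConn o a₃)ᶜ) ∩ openConn a₂ o)
            * ((prodBernoulli w).real ((openConn a₂ a₁)ᶜ ∩ (openConn a₂ a₃)ᶜ ∩ ((openConn o a₁)ᶜ ∩ (openConn o a₃)ᶜ) ∩ openConn a₂ b)
              - (prodBernoulli w).real ((openConn a₂ a₁)ᶜ ∩ (openConn a₂ a₃)ᶜ ∩ ((openConn o a₁)ᶜ ∩ (openConn o a₃)ᶜ) ∩ (openConn a₁ b ∩ openConn a₃ b))))) →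
      (prodBernoulli w).real ((openConn o a₁ ∪ openConn o a₂ ∪ openConn o a₃) \ openConn o b) ≤
        (prodBernoulli w).real ((openConn a₃ b)ᶜ)) :
    ∀ (n : ℕ) (w : Sym2 (Fin n) → unitInterval) (o b x y z : Fin n) (t : ℝ),
      x ≠ y → x ≠ z → y ≠ z →
      1 - t ≤ (prodBernoulli w).real (openConn x b) →
      1 - t ≤ (prodBernoulli w).real (openConn y b) →
      1 - t ≤ (prodBernoulli w).real (openConn z b) →
      (prodBernoulli w).real ((openConn o x ∪ openConn o y ∪ openConn o z) \ openConn o b) ≤ t := by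
  intro n w o b x y z t hxy hxz hyz hx hy hz
  have T := eform3_of_residual hRES
  by_cases h1 : (prodBernoulli w).real (openConn z b) ≤ (prodBernoulli w).real (openConn x b)
  · by_cases h2 : (prodBernoulli w).real (openConn z b) ≤ (prodBernoulli w).real (openConn y b)
    · exact T n w o b x y z t hxy hxz hyz hz h1 h2
    · push Not at h2
      have h := T n w o b x z y t hxz hxy hyz.symm hy (h2.le.trans h1) h2.le
      rwa [threeRelays_union_swap] at h
  · push Not at h1
    by_cases h3 : (prodBernoulli w).real (openConn x b) ≤ (prodBernoulli w).real (openConn y b)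
    · have h := T n w o b y z x t hyz hxy.symm hxz.symm hx h3 h1.le
      rwa [threeRelays_union_rotate] at h
    · push Not at h3
      have h := T n w o b x z y t hxz hxy hyz.symm hy h3.le (h3.le.trans h1.le)
      rwa [threeRelays_union_swap] at h

/-- **`AdditiveGluing` for at most three relays besides the target, from the residual.**  For every weighted graph, every relay
set `A` with `(A.erase b).card ≤ 3`, every `o, b` and `t ≥ 0` with `μ(a ↔ b) ≥ 1 − t` on `A`: `μ(o ↔ A) − t ≤ μ(o ↔ b)`.
Bookkeeping as in `additiveGluing_of_erase_card_le_three_of_regionCert` (deep seat r2): `o ∈ A` trivial; at most two further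
relays by the landed two-relay theorems; three relays by `threeRelays_eform_of_residual`.
[cite: KozmaNitzan2024, Conjecture 1 (p. 3), Theorem 2 (§3.1, pp. 8–9)] -/
theorem additiveGluing_of_erase_card_le_three_of_residual
    (hRES : ∀ (n : ℕ) (w : Sym2 (Fin n) → unitInterval) (o b a₁ a₂ a₃ : Fin n),
      a₁ ≠ a₂ → a₁ ≠ a₃ → a₂ ≠ a₃ → o ≠ a₁ → o ≠ a₂ → o ≠ a₃ →
      -- `a₃` worst, `τ₁ ≤ τ₂` (w.l.o.g.), nontrivial, bad
      (prodBernoulli w).real (openConn a₃ b) ≤ (prodBernoulli w).real (openConn a₁ b) →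
      (prodBernoulli w).real (openConn a₁ b) ≤ (prodBernoulli w).real (openConn a₂ b) →
      (prodBernoulli w).real (openConn o b) < (prodBernoulli w).real (openConn a₃ b) →
      (prodBernoulli w).real (openConn b a₁ ∩ openConn b a₂ ∩ (openConn b a₃)ᶜ) <
        (prodBernoulli w).real (openConn b a₃ ∩ (openConn b a₁)ᶜ ∩ (openConn b a₂)ᶜ) →
      -- the single-exchange charts fail: ¬(G1), ¬(G2)
      (prodBernoulli w).real (openConn o a₁ ∩ (openConn o a₂)ᶜ ∩ (openConn o a₃)ᶜ ∩ openConn a₁ b) + (prodBernoulli w).real ((openConn o a₁ ∪ openConn o a₂ ∪ openConn o a₃)ᶜ ∩ (openConn a₃ b)ᶜ) <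
        (prodBernoulli w).real (openConn o a₁ ∩ (openConn o a₂)ᶜ ∩ (openConn o a₃)ᶜ ∩ openConn a₃ b) →
      (prodBernoulli w).real (openConn o a₂ ∩ (openConn o a₁)ᶜ ∩ (openConn o a₃)ᶜ ∩ openConn a₂ b) + (prodBernoulli w).real ((openConn o a₁ ∪ openConn o a₂ ∪ openConn o a₃)ᶜ ∩ (openConn a₃ b)ᶜ) <
        (prodBernoulli w).real (openConn o a₂ ∩ (openConn o a₁)ᶜ ∩ (openConn o a₃)ᶜ ∩ openConn a₃ b) →
      -- the two-weak-singles charts B, C, D fail (at most one single refined attachment is `≤ 1/2`)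
      ¬ (2 * (prodBernoulli w).real ((openConn a₁ a₂)ᶜ ∩ (openConn a₁ a₃)ᶜ ∩ ((openConn o a₂)ᶜ ∩ (openConn o a₃)ᶜ) ∩ openConn a₁ o) ≤ (prodBernoulli w).real ((openConn a₁ a₂)ᶜ ∩ (openConn a₁ a₃)ᶜ ∩ ((openConn o a₂)ᶜ ∩ (openConn o a₃)ᶜ)) ∧
         2 * (prodBernoulli w).real ((openConn a₂ a₁)ᶜ ∩ (openConn a₂ a₃)ᶜ ∩ ((openConn o a₁)ᶜ ∩ (openConn o a₃)ᶜ) ∩ openConn a₂ o) ≤ (prodBernoulli w).real ((openConn a₂ a₁)ᶜ ∩ (openConn a₂ a₃)ᶜ ∩ ((openConn o a₁)ᶜ ∩ (openConn o a₃)ᶜ))) →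
      ¬ (2 * (prodBernoulli w).real ((openConn a₂ a₁)ᶜ ∩ (openConn a₂ a₃)ᶜ ∩ ((openConn o a₁)ᶜ ∩ (openConn o a₃)ᶜ) ∩ openConn a₂ o) ≤ (prodBernoulli w).real ((openConn a₂ a₁)ᶜ ∩ (openConn a₂ a₃)ᶜ ∩ ((openConn o a₁)ᶜ ∩ (openConn o a₃)ᶜ)) ∧
         2 * (prodBernoulli w).real ((openConn a₃ a₁)ᶜ ∩ (openConn a₃ a₂)ᶜ ∩ ((openConn o a₁)ᶜ ∩ (openConn o a₂)ᶜ) ∩ openConn a₃ o) ≤ (prodBernoulli w).real ((openConn a₃ a₁)ᶜ ∩ (openConn a₃ a₂)ᶜ ∩ ((openConn o a₁)ᶜ ∩ (openConn o a₂)ᶜ))) →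
      ¬ (2 * (prodBernoulli w).real ((openConn a₁ a₂)ᶜ ∩ (openConn a₁ a₃)ᶜ ∩ ((openConn o a₂)ᶜ ∩ (openConn o a₃)ᶜ) ∩ openConn a₁ o) ≤ (prodBernoulli w).real ((openConn a₁ a₂)ᶜ ∩ (openConn a₁ a₃)ᶜ ∩ ((openConn o a₂)ᶜ ∩ (openConn o a₃)ᶜ)) ∧
         2 * (prodBernoulli w).real ((openConn a₃ a₁)ᶜ ∩ (openConn a₃ a₂)ᶜ ∩ ((openConn o a₁)ᶜ ∩ (openConn o a₂)ᶜ) ∩ openConn a₃ o) ≤ (prodBernoulli w).real ((openConn a₃ a₁)ᶜ ∩ (openConn a₃ a₂)ᶜ ∩ ((openConn o a₁)ᶜ ∩ (openConn o a₂)ᶜ))) →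
      -- the Kozma–Nitzan Theorem-2 certificate with room (T1) fails
      ¬ (0 ≤
      (prodBernoulli w).real ((openConn a₁ a₃)ᶜ ∩ (openConn a₂ a₃)ᶜ ∩ (openConn a₁ o ∪ openConn a₂ o)) *
            (prodBernoulli w).real ((openConn a₁ a₂)ᶜ ∩ (openConn a₁ a₃)ᶜ : Set (BondConfig (Fin n))) *
            (prodBernoulli w).real ((openConn a₂ a₁)ᶜ ∩ (openConn a₂ a₃)ᶜ : Set (BondConfig (Fin n))) *
          ((prodBernoulli w).real ((openConn a₁ a₃)ᶜ ∩ (openConn a₂ a₃)ᶜ ∩ (openConn a₁ b ∩ openConn a₂ b)) -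
            (prodBernoulli w).real ((openConn a₁ a₃)ᶜ ∩ (openConn a₂ a₃)ᶜ ∩ openConn a₃ b)) +
        (prodBernoulli w).real ((openConn a₁ a₂)ᶜ ∩ (openConn a₁ a₃)ᶜ ∩ openConn a₁ o) *
            (prodBernoulli w).real ((openConn a₁ a₃)ᶜ ∩ (openConn a₂ a₃)ᶜ : Set (BondConfig (Fin n))) *
            (prodBernoulli w).real ((openConn a₂ a₁)ᶜ ∩ (openConn a₂ a₃)ᶜ : Set (BondConfig (Fin n))) *
          ((prodBernoulli w).real ((openConn a₁ a₂)ᶜ ∩ (openConn a₁ a₃)ᶜ ∩ openConn a₁ b) -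
            (prodBernoulli w).real ((openConn a₁ a₂)ᶜ ∩ (openConn a₁ a₃)ᶜ ∩ (openConn a₂ b ∩ openConn a₃ b))) +
        (prodBernoulli w).real ((openConn a₂ a₁)ᶜ ∩ (openConn a₂ a₃)ᶜ ∩ openConn a₂ o) *
            (prodBernoulli w).real ((openConn a₁ a₃)ᶜ ∩ (openConn a₂ a₃)ᶜ : Set (BondConfig (Fin n))) *
            (prodBernoulli w).real ((openConn a₁ a₂)ᶜ ∩ (openConn a₁ a₃)ᶜ : Set (BondConfig (Fin n))) *
          ((prodBernoulli w).real ((openConn a₂ a₁)ᶜ ∩ (openConn a₂ a₃)ᶜ ∩ openConn a₂ b) -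
            (prodBernoulli w).real ((openConn a₂ a₁)ᶜ ∩ (openConn a₂ a₃)ᶜ ∩ (openConn a₁ b ∩ openConn a₃ b))) +
        (prodBernoulli w).real ((openConn a₁ a₂)ᶜ ∩ (openConn a₁ a₃)ᶜ : Set (BondConfig (Fin n))) *
            (prodBernoulli w).real ((openConn a₂ a₁)ᶜ ∩ (openConn a₂ a₃)ᶜ : Set (BondConfig (Fin n))) *
            (prodBernoulli w).real ((openConn a₁ a₃)ᶜ ∩ (openConn a₂ a₃)ᶜ : Set (BondConfig (Fin n))) *
          (prodBernoulli w).real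
            ((openConn o a₁ ∪ openConn o a₂ ∪ openConn o a₃)ᶜ ∩ (openConn a₃ b)ᶜ : Set (BondConfig (Fin n)))) →
      -- the refined Kozma–Nitzan certificate (source sets with the observer adjoined) fails
      ¬ (0 < (prodBernoulli w).real
          ((openConn a₁ a₃)ᶜ ∩ (openConn a₂ a₃)ᶜ ∩ (openConn o a₃)ᶜ : Set (BondConfig (Fin n))) ∧
        0 < (prodBernoulli w).real
          ((openConn a₁ a₂)ᶜ ∩ (openConn a₁ a₃)ᶜ ∩ ((openConn o a₂)ᶜ ∩ (openConn o a₃)ᶜ) : Set (BondConfig (Fin n))) ∧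
        0 < (prodBernoulli w).real
          ((openConn a₂ a₁)ᶜ ∩ (openConn a₂ a₃)ᶜ ∩ ((openConn o a₁)ᶜ ∩ (openConn o a₃)ᶜ) : Set (BondConfig (Fin n))) ∧
        0 ≤
        (prodBernoulli w).real ((openConn a₁ a₂)ᶜ ∩ (openConn a₁ a₃)ᶜ ∩ ((openConn o a₂)ᶜ ∩ (openConn o a₃)ᶜ) : Set (BondConfig (Fin n)))
          * (prodBernoulli w).real ((openConn a₂ a₁)ᶜ ∩ (openConn a₂ a₃)ᶜ ∩ ((openConn o a₁)ᶜ ∩ (openConn o a₃)ᶜ) : Set (BondConfig (Fin n)))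
          * ((prodBernoulli w).real ((openConn a₁ a₃)ᶜ ∩ (openConn a₂ a₃)ᶜ ∩ (openConn o a₃)ᶜ ∩ (openConn a₁ o ∪ openConn a₂ o))
            * ((prodBernoulli w).real ((openConn a₁ a₃)ᶜ ∩ (openConn a₂ a₃)ᶜ ∩ (openConn o a₃)ᶜ ∩ (openConn a₁ b ∩ openConn a₂ b))
              - (prodBernoulli w).real ((openConn a₁ a₃)ᶜ ∩ (openConn a₂ a₃)ᶜ ∩ (openConn o a₃)ᶜ ∩ openConn a₃ b)))
      + (prodBernoulli w).real ((openConn a₂ a₁)ᶜ ∩ (openConn a₂ a₃)ᶜ ∩ ((openConn o a₁)ᶜ ∩ (openConn o a₃)ᶜ) : Set (BondConfig (Fin n)))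
          * (prodBernoulli w).real ((openConn a₁ a₃)ᶜ ∩ (openConn a₂ a₃)ᶜ ∩ (openConn o a₃)ᶜ : Set (BondConfig (Fin n)))
          * ((prodBernoulli w).real ((openConn a₁ a₂)ᶜ ∩ (openConn a₁ a₃)ᶜ ∩ ((openConn o a₂)ᶜ ∩ (openConn o a₃)ᶜ) ∩ openConn a₁ o)
            * ((prodBernoulli w).real ((openConn a₁ a₂)ᶜ ∩ (openConn a₁ a₃)ᶜ ∩ ((openConn o a₂)ᶜ ∩ (openConn o a₃)ᶜ) ∩ openConn a₁ b)
              - (prodBernoulli w).real ((openConn a₁ a₂)ᶜ ∩ (openConn a₁ a₃)ᶜ ∩ ((openConn o a₂)ᶜ ∩ (openConn o a₃)ᶜ) ∩ (openConn a₂ b ∩ openConn a₃ b))))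
      + (prodBernoulli w).real ((openConn a₁ a₂)ᶜ ∩ (openConn a₁ a₃)ᶜ ∩ ((openConn o a₂)ᶜ ∩ (openConn o a₃)ᶜ) : Set (BondConfig (Fin n)))
          * (prodBernoulli w).real ((openConn a₁ a₃)ᶜ ∩ (openConn a₂ a₃)ᶜ ∩ (openConn o a₃)ᶜ : Set (BondConfig (Fin n)))
          * ((prodBernoulli w).real ((openConn a₂ a₁)ᶜ ∩ (openConn a₂ a₃)ᶜ ∩ ((openConn o a₁)ᶜ ∩ (openConn o a₃)ᶜ) ∩ openConn a₂ o)
            * ((prodBernoulli w).real ((openConn a₂ a₁)ᶜ ∩ (openConn a₂ a₃)ᶜ ∩ ((openConn o a₁)ᶜ ∩ (openConn o a₃)ᶜ) ∩ openConn a₂ b)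
              - (prodBernoulli w).real ((openConn a₂ a₁)ᶜ ∩ (openConn a₂ a₃)ᶜ ∩ ((openConn o a₁)ᶜ ∩ (openConn o a₃)ᶜ) ∩ (openConn a₁ b ∩ openConn a₃ b))))) →
      (prodBernoulli w).real ((openConn o a₁ ∪ openConn o a₂ ∪ openConn o a₃) \ openConn o b) ≤
        (prodBernoulli w).real ((openConn a₃ b)ᶜ)) :
    ∀ (n : ℕ) (w : Sym2 (Fin n) → unitInterval) (A : Finset (Fin n)) (o b : Fin n) (t : ℝ),
      (A.erase b).card ≤ 3 → 0 ≤ t →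
      (∀ a ∈ A, 1 - t ≤ (prodBernoulli w).real (openConn a b)) →
      (prodBernoulli w).real (⋃ a ∈ A, openConn o a) - t ≤ (prodBernoulli w).real (openConn o b) := by
  intro n w A o b t hcard ht hrel
  have hm : ∀ s : Set (BondConfig (Fin n)), MeasurableSet s := fun _ => MeasurableSet.of_discrete
  have hU1 : (prodBernoulli w).real (⋃ a ∈ A, (openConn o a : Set (BondConfig (Fin n)))) ≤ 1 := measureReal_le_one
  by_cases hoA : o ∈ A
  · have h := hrel o hoA
    have hoo : (prodBernoulli w).real (openConn o b : Set (BondConfig (Fin n))) =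
        (prodBernoulli w).real (openConn o b : Set (BondConfig (Fin n))) := rfl
    linarith
  by_cases hsmall : (A.erase b).card ≤ 2
  · by_cases hbA : b ∈ A
    · have hA3 : A.card ≤ 3 := by
        have := Finset.card_erase_of_mem hbA; omega
      have hK := stub_goodCardLeThree_k42 n w A o b hbA hoA hA3 t (fun _ => b) (fun _ => hbA) hrel
      have hP : 0 ≤ ∑ W ∈ (Finset.univ : Finset (Finset (Fin n))).filter (fun W => o ∈ W ∧ Disjoint W A),
          (prodBernoulli w).real {ω : BondConfig (Fin n) | openCluster ω o = (W : Set (Fin n))} *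
            (prodBernoulli w).real (openConnIn ((W : Set (Fin n))ᶜ) b b)ᶜ :=
        Finset.sum_nonneg fun W _ => mul_nonneg measureReal_nonneg measureReal_nonneg
      have h1 := measureReal_inter_add_sdiff (μ := prodBernoulli w) (s := ⋃ a ∈ A, openConn o a) (hm (openConn o b))
        (h := measure_ne_top _ _)
      have h2 : (prodBernoulli w).real ((⋃ a ∈ A, openConn o a) ∩ openConn o b) ≤
          (prodBernoulli w).real (openConn o b : Set (BondConfig (Fin n))) := measureReal_mono Set.inter_subset_right
      have h3 : ((⋃ a ∈ A, openConn o a) \ openConn o b : Set (BondConfig (Fin n))) =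
          (⋃ a ∈ A, openConn o a) ∩ (openConn o b)ᶜ := Set.sdiff_eq _ _
      rw [h3] at h1
      linarith
    · have hA2 : A.card ≤ 2 := by rwa [Finset.erase_eq_of_notMem hbA] at hsmall
      exact additiveGluing_of_card_le_two n w A o b t hA2 ht hrel
  · have h3 : (A.erase b).card = 3 := by omega
    obtain ⟨x, y, z, hxy, hxz, hyz, hE⟩ := Finset.card_eq_three.1 h3
    have hxA : x ∈ A := Finset.mem_of_mem_erase (by rw [hE]; simp)
    have hyA : y ∈ A := Finset.mem_of_mem_erase (by rw [hE]; simp)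
    have hzA : z ∈ A := Finset.mem_of_mem_erase (by rw [hE]; simp)
    have hT := threeRelays_eform_of_residual hRES n w o b x y z t hxy hxz hyz (hrel x hxA) (hrel y hyA) (hrel z hzA)
    have hsub : (⋃ a ∈ A, (openConn o a : Set (BondConfig (Fin n)))) ⊆
        openConn o b ∪ ((openConn o x ∪ openConn o y ∪ openConn o z) \ openConn o b) := by
      intro ω hω
      simp only [Set.mem_iUnion] at hω
      obtain ⟨a, haA, ha⟩ := hω
      by_cases hob : ω ∈ (openConn o b : Set (BondConfig (Fin n)))
      · exact Or.inl hob
      · right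
        refine ⟨?_, hob⟩
        have hab : a ≠ b := by
          rintro rfl; exact hob ha
        have haE : a ∈ A.erase b := Finset.mem_erase.2 ⟨hab, haA⟩
        rw [hE] at haE
        simp only [Finset.mem_insert, Finset.mem_singleton] at haE
        rcases haE with rfl | rfl | rfl
        · exact Or.inl (Or.inl ha)
        · exact Or.inl (Or.inr ha)
        · exact Or.inr ha
    have hle := (measureReal_mono hsub (measure_ne_top _ _)).trans
      (measureReal_union_le (μ := prodBernoulli w) (openConn o b)
        ((openConn o x ∪ openConn o y ∪ openConn o z) \ openConn o b))
    linarith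

/-- **The registered stub `stub_threeRelaysFullTieAllBad_pl` of the official skeleton follows from the residual** (its tie,
all-bad and positivity hypotheses are not needed). [cite: KozmaNitzan2024, Theorem 2 (§3.1, pp. 8–9), Lemma 3 (pp. 6–7)] -/
theorem threeRelaysFullTieAllBad_of_residual
    (hRES : ∀ (n : ℕ) (w : Sym2 (Fin n) → unitInterval) (o b a₁ a₂ a₃ : Fin n),
      a₁ ≠ a₂ → a₁ ≠ a₃ → a₂ ≠ a₃ → o ≠ a₁ → o ≠ a₂ → o ≠ a₃ →
      -- `a₃` worst, `τ₁ ≤ τ₂` (w.l.o.g.), nontrivial, bad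
      (prodBernoulli w).real (openConn a₃ b) ≤ (prodBernoulli w).real (openConn a₁ b) →
      (prodBernoulli w).real (openConn a₁ b) ≤ (prodBernoulli w).real (openConn a₂ b) →
      (prodBernoulli w).real (openConn o b) < (prodBernoulli w).real (openConn a₃ b) →
      (prodBernoulli w).real (openConn b a₁ ∩ openConn b a₂ ∩ (openConn b a₃)ᶜ) <
        (prodBernoulli w).real (openConn b a₃ ∩ (openConn b a₁)ᶜ ∩ (openConn b a₂)ᶜ) →
      -- the single-exchange charts fail: ¬(G1), ¬(G2)
      (prodBernoulli w).real (openConn o a₁ ∩ (openConn o a₂)ᶜ ∩ (openConn o a₃)ᶜ ∩ openConn a₁ b) + (prodBernoulli w).real ((openConn o a₁ ∪ openConn o a₂ ∪ openConn o a₃)ᶜ ∩ (openConn a₃ b)ᶜ) <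
        (prodBernoulli w).real (openConn o a₁ ∩ (openConn o a₂)ᶜ ∩ (openConn o a₃)ᶜ ∩ openConn a₃ b) →
      (prodBernoulli w).real (openConn o a₂ ∩ (openConn o a₁)ᶜ ∩ (openConn o a₃)ᶜ ∩ openConn a₂ b) + (prodBernoulli w).real ((openConn o a₁ ∪ openConn o a₂ ∪ openConn o a₃)ᶜ ∩ (openConn a₃ b)ᶜ) <
        (prodBernoulli w).real (openConn o a₂ ∩ (openConn o a₁)ᶜ ∩ (openConn o a₃)ᶜ ∩ openConn a₃ b) →
      -- the two-weak-singles charts B, C, D fail (at most one single refined attachment is `≤ 1/2`)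
      ¬ (2 * (prodBernoulli w).real ((openConn a₁ a₂)ᶜ ∩ (openConn a₁ a₃)ᶜ ∩ ((openConn o a₂)ᶜ ∩ (openConn o a₃)ᶜ) ∩ openConn a₁ o) ≤ (prodBernoulli w).real ((openConn a₁ a₂)ᶜ ∩ (openConn a₁ a₃)ᶜ ∩ ((openConn o a₂)ᶜ ∩ (openConn o a₃)ᶜ)) ∧
         2 * (prodBernoulli w).real ((openConn a₂ a₁)ᶜ ∩ (openConn a₂ a₃)ᶜ ∩ ((openConn o a₁)ᶜ ∩ (openConn o a₃)ᶜ) ∩ openConn a₂ o) ≤ (prodBernoulli w).real ((openConn a₂ a₁)ᶜ ∩ (openConn a₂ a₃)ᶜ ∩ ((openConn o a₁)ᶜ ∩ (openConn o a₃)ᶜ))) →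
      ¬ (2 * (prodBernoulli w).real ((openConn a₂ a₁)ᶜ ∩ (openConn a₂ a₃)ᶜ ∩ ((openConn o a₁)ᶜ ∩ (openConn o a₃)ᶜ) ∩ openConn a₂ o) ≤ (prodBernoulli w).real ((openConn a₂ a₁)ᶜ ∩ (openConn a₂ a₃)ᶜ ∩ ((openConn o a₁)ᶜ ∩ (openConn o a₃)ᶜ)) ∧
         2 * (prodBernoulli w).real ((openConn a₃ a₁)ᶜ ∩ (openConn a₃ a₂)ᶜ ∩ ((openConn o a₁)ᶜ ∩ (openConn o a₂)ᶜ) ∩ openConn a₃ o) ≤ (prodBernoulli w).real ((openConn a₃ a₁)ᶜ ∩ (openConn a₃ a₂)ᶜ ∩ ((openConn o a₁)ᶜ ∩ (openConn o a₂)ᶜ))) →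
      ¬ (2 * (prodBernoulli w).real ((openConn a₁ a₂)ᶜ ∩ (openConn a₁ a₃)ᶜ ∩ ((openConn o a₂)ᶜ ∩ (openConn o a₃)ᶜ) ∩ openConn a₁ o) ≤ (prodBernoulli w).real ((openConn a₁ a₂)ᶜ ∩ (openConn a₁ a₃)ᶜ ∩ ((openConn o a₂)ᶜ ∩ (openConn o a₃)ᶜ)) ∧
         2 * (prodBernoulli w).real ((openConn a₃ a₁)ᶜ ∩ (openConn a₃ a₂)ᶜ ∩ ((openConn o a₁)ᶜ ∩ (openConn o a₂)ᶜ) ∩ openConn a₃ o) ≤ (prodBernoulli w).real ((openConn a₃ a₁)ᶜ ∩ (openConn a₃ a₂)ᶜ ∩ ((openConn o a₁)ᶜ ∩ (openConn o a₂)ᶜ))) →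
      -- the Kozma–Nitzan Theorem-2 certificate with room (T1) fails
      ¬ (0 ≤
      (prodBernoulli w).real ((openConn a₁ a₃)ᶜ ∩ (openConn a₂ a₃)ᶜ ∩ (openConn a₁ o ∪ openConn a₂ o)) *
            (prodBernoulli w).real ((openConn a₁ a₂)ᶜ ∩ (openConn a₁ a₃)ᶜ : Set (BondConfig (Fin n))) *
            (prodBernoulli w).real ((openConn a₂ a₁)ᶜ ∩ (openConn a₂ a₃)ᶜ : Set (BondConfig (Fin n))) *
          ((prodBernoulli w).real ((openConn a₁ a₃)ᶜ ∩ (openConn a₂ a₃)ᶜ ∩ (openConn a₁ b ∩ openConn a₂ b)) -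
            (prodBernoulli w).real ((openConn a₁ a₃)ᶜ ∩ (openConn a₂ a₃)ᶜ ∩ openConn a₃ b)) +
        (prodBernoulli w).real ((openConn a₁ a₂)ᶜ ∩ (openConn a₁ a₃)ᶜ ∩ openConn a₁ o) *
            (prodBernoulli w).real ((openConn a₁ a₃)ᶜ ∩ (openConn a₂ a₃)ᶜ : Set (BondConfig (Fin n))) *
            (prodBernoulli w).real ((openConn a₂ a₁)ᶜ ∩ (openConn a₂ a₃)ᶜ : Set (BondConfig (Fin n))) *
          ((prodBernoulli w).real ((openConn a₁ a₂)ᶜ ∩ (openConn a₁ a₃)ᶜ ∩ openConn a₁ b) -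
            (prodBernoulli w).real ((openConn a₁ a₂)ᶜ ∩ (openConn a₁ a₃)ᶜ ∩ (openConn a₂ b ∩ openConn a₃ b))) +
        (prodBernoulli w).real ((openConn a₂ a₁)ᶜ ∩ (openConn a₂ a₃)ᶜ ∩ openConn a₂ o) *
            (prodBernoulli w).real ((openConn a₁ a₃)ᶜ ∩ (openConn a₂ a₃)ᶜ : Set (BondConfig (Fin n))) *
            (prodBernoulli w).real ((openConn a₁ a₂)ᶜ ∩ (openConn a₁ a₃)ᶜ : Set (BondConfig (Fin n))) *
          ((prodBernoulli w).real ((openConn a₂ a₁)ᶜ ∩ (openConn a₂ a₃)ᶜ ∩ openConn a₂ b) -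
            (prodBernoulli w).real ((openConn a₂ a₁)ᶜ ∩ (openConn a₂ a₃)ᶜ ∩ (openConn a₁ b ∩ openConn a₃ b))) +
        (prodBernoulli w).real ((openConn a₁ a₂)ᶜ ∩ (openConn a₁ a₃)ᶜ : Set (BondConfig (Fin n))) *
            (prodBernoulli w).real ((openConn a₂ a₁)ᶜ ∩ (openConn a₂ a₃)ᶜ : Set (BondConfig (Fin n))) *
            (prodBernoulli w).real ((openConn a₁ a₃)ᶜ ∩ (openConn a₂ a₃)ᶜ : Set (BondConfig (Fin n))) *
          (prodBernoulli w).real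
            ((openConn o a₁ ∪ openConn o a₂ ∪ openConn o a₃)ᶜ ∩ (openConn a₃ b)ᶜ : Set (BondConfig (Fin n)))) →
      -- the refined Kozma–Nitzan certificate (source sets with the observer adjoined) fails
      ¬ (0 < (prodBernoulli w).real
          ((openConn a₁ a₃)ᶜ ∩ (openConn a₂ a₃)ᶜ ∩ (openConn o a₃)ᶜ : Set (BondConfig (Fin n))) ∧
        0 < (prodBernoulli w).real
          ((openConn a₁ a₂)ᶜ ∩ (openConn a₁ a₃)ᶜ ∩ ((openConn o a₂)ᶜ ∩ (openConn o a₃)ᶜ) : Set (BondConfig (Fin n))) ∧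
        0 < (prodBernoulli w).real
          ((openConn a₂ a₁)ᶜ ∩ (openConn a₂ a₃)ᶜ ∩ ((openConn o a₁)ᶜ ∩ (openConn o a₃)ᶜ) : Set (BondConfig (Fin n))) ∧
        0 ≤
        (prodBernoulli w).real ((openConn a₁ a₂)ᶜ ∩ (openConn a₁ a₃)ᶜ ∩ ((openConn o a₂)ᶜ ∩ (openConn o a₃)ᶜ) : Set (BondConfig (Fin n)))
          * (prodBernoulli w).real ((openConn a₂ a₁)ᶜ ∩ (openConn a₂ a₃)ᶜ ∩ ((openConn o a₁)ᶜ ∩ (openConn o a₃)ᶜ) : Set (BondConfig (Fin n)))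
          * ((prodBernoulli w).real ((openConn a₁ a₃)ᶜ ∩ (openConn a₂ a₃)ᶜ ∩ (openConn o a₃)ᶜ ∩ (openConn a₁ o ∪ openConn a₂ o))
            * ((prodBernoulli w).real ((openConn a₁ a₃)ᶜ ∩ (openConn a₂ a₃)ᶜ ∩ (openConn o a₃)ᶜ ∩ (openConn a₁ b ∩ openConn a₂ b))
              - (prodBernoulli w).real ((openConn a₁ a₃)ᶜ ∩ (openConn a₂ a₃)ᶜ ∩ (openConn o a₃)ᶜ ∩ openConn a₃ b)))
      + (prodBernoulli w).real ((openConn a₂ a₁)ᶜ ∩ (openConn a₂ a₃)ᶜ ∩ ((openConn o a₁)ᶜ ∩ (openConn o a₃)ᶜ) : Set (BondConfig (Fin n)))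
          * (prodBernoulli w).real ((openConn a₁ a₃)ᶜ ∩ (openConn a₂ a₃)ᶜ ∩ (openConn o a₃)ᶜ : Set (BondConfig (Fin n)))
          * ((prodBernoulli w).real ((openConn a₁ a₂)ᶜ ∩ (openConn a₁ a₃)ᶜ ∩ ((openConn o a₂)ᶜ ∩ (openConn o a₃)ᶜ) ∩ openConn a₁ o)
            * ((prodBernoulli w).real ((openConn a₁ a₂)ᶜ ∩ (openConn a₁ a₃)ᶜ ∩ ((openConn o a₂)ᶜ ∩ (openConn o a₃)ᶜ) ∩ openConn a₁ b)
              - (prodBernoulli w).real ((openConn a₁ a₂)ᶜ ∩ (openConn a₁ a₃)ᶜ ∩ ((openConn o a₂)ᶜ ∩ (openConn o a₃)ᶜ) ∩ (openConn a₂ b ∩ openConn a₃ b))))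
      + (prodBernoulli w).real ((openConn a₁ a₂)ᶜ ∩ (openConn a₁ a₃)ᶜ ∩ ((openConn o a₂)ᶜ ∩ (openConn o a₃)ᶜ) : Set (BondConfig (Fin n)))
          * (prodBernoulli w).real ((openConn a₁ a₃)ᶜ ∩ (openConn a₂ a₃)ᶜ ∩ (openConn o a₃)ᶜ : Set (BondConfig (Fin n)))
          * ((prodBernoulli w).real ((openConn a₂ a₁)ᶜ ∩ (openConn a₂ a₃)ᶜ ∩ ((openConn o a₁)ᶜ ∩ (openConn o a₃)ᶜ) ∩ openConn a₂ o)
            * ((prodBernoulli w).real ((openConn a₂ a₁)ᶜ ∩ (openConn a₂ a₃)ᶜ ∩ ((openConn o a₁)ᶜ ∩ (openConn o a₃)ᶜ) ∩ openConn a₂ b)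
              - (prodBernoulli w).real ((openConn a₂ a₁)ᶜ ∩ (openConn a₂ a₃)ᶜ ∩ ((openConn o a₁)ᶜ ∩ (openConn o a₃)ᶜ) ∩ (openConn a₁ b ∩ openConn a₃ b))))) →
      (prodBernoulli w).real ((openConn o a₁ ∪ openConn o a₂ ∪ openConn o a₃) \ openConn o b) ≤
        (prodBernoulli w).real ((openConn a₃ b)ᶜ)) :
    ∀ (n : ℕ) (w : Sym2 (Fin n) → unitInterval) (o b a₁ a₂ a₃ : Fin n) (t : ℝ), a₁ ≠ a₂ → a₁ ≠ a₃ → a₂ ≠ a₃ → 1 - t ≤ (prodBernoulli w).real (openConn a₃ b) → (prodBernoulli w).real (openConn a₃ b) ≤ (prodBernoulli w).real (openConn a₁ b) → (prodBernoulli w).real (openConn a₃ b) ≤ (prodBernoulli w).real (openConn a₂ b) → (prodBernoulli w).real (openConn a₁ b) ≤ (prodBernoulli w).real (openConn a₃ b) → (prodBernoulli w).real (openConn a₂ b) ≤ (prodBernoulli w).real (openConn a₃ b) → 0 < (prodBernoulli w).real ((openConn a₁ a₂)ᶜ ∩ (openConn a₁ a₃)ᶜ : Set (BondConfig (Fin n)))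 → 0 < (prodBernoulli w).real ((openConn a₂ a₁)ᶜ ∩ (openConn a₂ a₃)ᶜ : Set (BondConfig (Fin n))) → 0 < (prodBernoulli w).real ((openConn a₁ a₃)ᶜ ∩ (openConn a₂ a₃)ᶜ : Set (BondConfig (Fin n))) → (prodBernoulli w).real (openConn b a₂ ∩ openConn b a₃ ∩ (openConn b a₁)ᶜ) < (prodBernoulli w).real (openConn b a₁ ∩ (openConn b a₂)ᶜ ∩ (openConn b a₃)ᶜ) → (prodBernoulli w).real (openConn b a₁ ∩ openConn b a₃ ∩ (openConn b a₂)ᶜ) < (prodBernoulli w).real (openConn b a₂ ∩ (openConn b a₁)ᶜ ∩ (openConn b a₃)ᶜ) → (prodBernoulli w).real (openConn b a₁ ∩ openConn b a₂ ∩ (openConn b a₃)ᶜ) < (prodBernoulli w).real (openConn b a₃ ∩ (openConn b a₁)ᶜ ∩ (openConn b a₂)ᶜ) → (prodBernoulli w).real ((openConn o a₁ ∪ openConn o a₂ ∪ openConn o a₃) \ openConn o b) ≤ t := by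
  intro n w o b a₁ a₂ a₃ t h12 h13 h23 hτ3 hτ31 hτ32 _ _ _ _ _ _ _ _
  exact eform3_of_residual hRES n w o b a₁ a₂ a₃ t h12 h13 h23 hτ3 hτ31 hτ32

end

end Summit.CriticalPhenomena.PercolationContinuityZ3.Theorems
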